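import Summits.AnomalousDissipation.AnomalousDissipation.Theorems.SolenoidalFractalHomogenisationLagrangianStepCellTimeOrbits
import Summits.AnomalousDissipation.AnomalousDissipation.Theorems.SolenoidalFractalHomogenisationLagrangianStepWeakSolRestrict
import Summits.AnomalousDissipation.AnomalousDissipation.Theorems.SolenoidalFractalHomogenisationLagrangianStepCellClauseCutsFamily
import Summits.AnomalousDissipation.AnomalousDissipation.Theorems.SolenoidalFractalHomogenisationRealisedQuasiStaticCellLawSingleMode
import HarnessLib

/-!
# K1L_D (stmt-AnomalousDissipation-27980), line «onelevel-design», brick Z4♭ CORE: the slow-vector clause (V) READ ON ONE GRID WINDOW of the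
# flat pair — modewise, cosine single-mode data, cell time, a.e. form (helper; `--supports … --as helper`; lead-k1l-onelevel-p1 g4)

`SlowVectorClauseF` (V) compares, in CELL time, every weak solution `w` of the cell problem (carrier `cellField W M hM ν _ n`, tensor `(1/n²)•(ν•S)`)
from the single slow mode `Re(e_ℓ)•p` with every weak solution `v` of the EFFECTIVE problem (carrier `0`, tensor `(1/n²)•(ν•S + (c/ν)•Φν S)`) from
the same datum: `2Σᵢ|modeCoeff ℓ (w t − v t) i|² ≤ err(t)²·∫‖Re(e_ℓ)p‖²` for a.e. `t ∈ (0,T)`.  `…CellTimeOrbits` (p682107) identified the window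
orbits of the FLAT pair of propagators (`Um1` along `E.level (m+1)` with `kbar(m+1)•S`; `Um` carrier-free with `kbar m • renormStep …`) with such
`w`, `v` (dictionary `…OneLevelScales`, phase `0` at grid times).  THIS FILE puts the two together:
* `modeCoeff_congr_ae` — `modeCoeff` only sees the a.e. class;
* **`ae_modeCoeff_window_sub_sq_le`** — for a regime level (`cellVisc (m+1) < ν₀`), a grid time `s = j·refresh (m+1) ∈ [0,1)`, a slow mode `ℓ ≠ 0`
  with `‖ℓ‖·⌈K/ν⌉ ≤ N(m+1)` and a unit polarisation `p ⊥ ℓ`: for a.e. cell time `t' ∈ (0, (1−s)·a)` (the WHOLE remaining horizon — the effective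
  orbit is extended to the double horizon `exists_effSol_of_window₂`, as (V) wants `v` on `2T`),
  `2Σᵢ |modeCoeff ℓ (Um1 s (s + t'/a) x_d − Um s (s + t'/a) x_d) i|² ≤ err(t')² · ∫‖d‖²`, `d = Re(e_ℓ)•p`, `x_d = toLp d`, with (V)'s error
  `err(t') = C·(C·(ν^σ + (‖ℓ‖⌈K/ν⌉/n)^σ)·min(1, r̄ t') + r̄·(M·W.period/ν))`, `r̄ = 8π²‖ℓ‖²·hiΛ·(ν + c/ν)/n²`.
What remains for Z4♭ (memo L8 §2): the endpoint upgrade (a.e. `t'` → the window's `s'`, weak continuity), the sine phase (two lattice-translated cosine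
data), the template bookkeeping `err ≤ Cz ρ^σz·min(1, rate·τ)`, and the assembly over slow modes (`…PropagatorClass`, Cauchy–Schwarz).
NOT a proof of Z4♭, of any registered stub, of the crux, or of AD; rung F-D1.A0.
-/

set_option linter.dupNamespace false  -- the summit-side namespace `Summit.AnomalousDissipation.AnomalousDissipation.…` repeats a component by design (D-0017)

noncomputable section

namespace Summit.AnomalousDissipation.AnomalousDissipation.Theorems.SolenoidalFractalHomogenisation.LagrangianStep.CellTime

open Literature.Analysis Literature.Analysis.FluidPDE Literature.Analysis.FluidPDE.Torus Literature.Analysis.FunctionSpaces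
open MeasureTheory Set Filter UnitAddTorus Function
open scoped ENNReal NNReal InnerProductSpace
open Literature.Analysis.FluidPDE.LatticeShear (LagrangianLatticeCarrier LatticeWord)
open Summit.AnomalousDissipation.AnomalousDissipation.Theorems.SolenoidalFractalHomogenisation.RealisedQuasiStaticCellLaw
  (memLp_two_of_memSobolev_one_complexify memSobolev_one_singleMode isWeaklyDivFree_singleMode)
open Summit.AnomalousDissipation.AnomalousDissipation.Theorems.SolenoidalFractalHomogenisation.LagrangianRenormalisationStep (cellVisc_pos')

variable {k : ℕ}

/-- `modeCoeff` only sees the a.e. class of the field. -/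
theorem modeCoeff_congr_ae {f g : VF} (h : f =ᵐ[volume] g) (ℓ : Fin 3 → ℤ) (i : Fin 3) : modeCoeff ℓ f i = modeCoeff ℓ g i := by
  unfold modeCoeff
  exact integral_congr_ae (h.mono fun x hx => by simp only [hx])

/-- The single-mode datum is in `L²`. -/
theorem memLp_singleMode (ℓ : Fin 3 → ℤ) (p : EuclideanSpace ℝ (Fin 3)) :
    MemLp (fun x : UnitAddTorus (Fin 3) => (UnitAddTorus.mFourier ℓ x).re • p) 2 volume :=
  memLp_two_of_memSobolev_one_complexify (memSobolev_one_singleMode ℓ p)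

/-- **The COARSE orbit as an effective solution on the DOUBLE horizon** (what (V) asks of `v`): a weak solution of the (V) effective problem
on `(0, 2(1−s)·a)` from `x`, identified with `Um s (s + t'/a) x` for a.e. `t' ∈ (0, (1−s)·a)` (Lions on the physical horizon `2(1−s)`, time
dilation, restriction of the horizon for `repr`). -/
theorem exists_effSol_of_window₂ (E : LagrangianLatticeCarrier k) (hL : E.LPermissible) (m : ℕ)
    (Φ : ℝ → FluidPDE.Torus.Visc4 (Fin 3) → FluidPDE.Torus.Visc4 (Fin 3))
    {S : FluidPDE.Torus.Visc4 (Fin 3)} {lo hi : ℝ} (hlo : 0 < lo) (hSn : FluidPDE.Torus.NearIso S lo hi)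
    (hΦSn : FluidPDE.Torus.NearIso (Φ (E.cellVisc (m + 1)) S) lo hi)
    {Um : ℝ → ℝ → (V2 →L[ℝ] V2)}
    (hUm : FluidPDE.Torus.IsPropagator 1 (fun (_ : ℝ) (_ : UnitAddTorus (Fin 3)) => (0 : EuclideanSpace ℝ (Fin 3)))
      (E.kbar m • renormStep (Φ (E.cellVisc (m + 1))) (E.gain / E.cellVisc (m + 1) ^ 2) S) Um)
    {s : ℝ} (hs0 : 0 ≤ s) (hs1 : s < 1) (x : V2) (hx : FunctionSpaces.Torus.IsWeaklyDivFree (x : VF)) :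
    ∃ v : ℝ → VF,
      FluidPDE.Torus.IsWeakTensorPassiveVectorOn 0 (2 * (1 - s) / (1 / E.a (m + 1)))
        ((1 / (E.N (m + 1) : ℝ) ^ 2) • (E.cellVisc (m + 1) • S +
          (E.gain / E.cellVisc (m + 1)) • Φ (E.cellVisc (m + 1)) ((1 / E.cellVisc (m + 1)) • (E.cellVisc (m + 1) • S))))
        (fun (_ : ℝ) (_ : UnitAddTorus (Fin 3)) => (0 : EuclideanSpace ℝ (Fin 3))) (x : VF) v ∧
      ∀ᵐ t' ∂(volume.restrict (Ioo 0 ((1 - s) / (1 / E.a (m + 1))))),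
        ∃ ht : MemLp (v t') 2 volume, ht.toLp (v t') = Um s (s + 1 / E.a (m + 1) * t') x := by
  have ha : 0 < E.a (m + 1) := E.a_pos (m + 1)
  have ha' : 0 < 1 / E.a (m + 1) := one_div_pos.2 ha
  have hg : 0 ≤ E.gain / E.cellVisc (m + 1) ^ 2 := div_nonneg E.gain_pos.le (sq_nonneg _)
  have h2 : 0 < 2 * (1 - s) := by linarith
  -- the free carrier on the long horizon
  have hb2 : MemLp (FunctionSpaces.Torus.stLift (fun (_ : ℝ) (_ : UnitAddTorus (Fin 3)) => (0 : EuclideanSpace ℝ (Fin 3)))) ∞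
      (volume.restrict (Ioo 0 (2 * (1 - s)) ×ˢ (univ : Set (EuclideanSpace ℝ (Fin 3))))) := memLp_top_const 0
  have hbdiv2 : ∀ᵐ t ∂(volume.restrict (Ioo (0:ℝ) (2 * (1 - s)))),
      FunctionSpaces.Torus.IsWeaklyDivFree ((fun (_ : ℝ) (_ : UnitAddTorus (Fin 3)) => (0 : EuclideanSpace ℝ (Fin 3))) t) :=
    ae_of_all _ fun t θ hθ => by simp
  have h𝔸 : FluidPDE.Torus.NearIso (E.kbar m • renormStep (Φ (E.cellVisc (m + 1))) (E.gain / E.cellVisc (m + 1) ^ 2) S)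
      (E.kbar m * lo) (E.kbar m * hi) :=
    (WindowDuality.nearIso_renormStep' hSn hΦSn hg).smul (E.kbar_pos m).le
  obtain ⟨v₀, hv₀⟩ := FluidPDE.Torus.exists_isWeakTensorPassiveVectorOn h2 h𝔸 (mul_pos (E.kbar_pos m) hlo) hb2 hbdiv2 (Lp.memLp x) hx
  -- its restriction to the window horizon is represented by `Um` (the shifted free carrier is the free carrier)
  have hv₀' : FluidPDE.Torus.IsWeakTensorPassiveVectorOn 0 (1 - s)
      (E.kbar m • renormStep (Φ (E.cellVisc (m + 1))) (E.gain / E.cellVisc (m + 1) ^ 2) S)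
      (fun τ => (fun (_ : ℝ) (_ : UnitAddTorus (Fin 3)) => (0 : EuclideanSpace ℝ (Fin 3))) (s + τ)) (x : VF) v₀ :=
    WeakSol.mono_horizon hv₀ (by linarith)
  have r := hUm.repr s hs0 hs1 (x : VF) (Lp.memLp x) hx v₀ hv₀'
  -- dilate
  have hv := hv₀.comp_mul_time ha'
  have hcar : (fun (t' : ℝ) (y : UnitAddTorus (Fin 3)) => (1 / E.a (m + 1)) •
      (fun (_ : ℝ) (_ : UnitAddTorus (Fin 3)) => (0 : EuclideanSpace ℝ (Fin 3))) (1 / E.a (m + 1) * t') y)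
      = fun (_ : ℝ) (_ : UnitAddTorus (Fin 3)) => (0 : EuclideanSpace ℝ (Fin 3)) := by
    funext t' y; simp
  have hten : (1 / E.a (m + 1)) • (E.kbar m • renormStep (Φ (E.cellVisc (m + 1))) (E.gain / E.cellVisc (m + 1) ^ 2) S)
      = (1 / (E.N (m + 1) : ℝ) ^ 2) • (E.cellVisc (m + 1) • S +
          (E.gain / E.cellVisc (m + 1)) • Φ (E.cellVisc (m + 1)) ((1 / E.cellVisc (m + 1)) • (E.cellVisc (m + 1) • S))) := by
    rw [show E.kbar m • renormStep (Φ (E.cellVisc (m + 1))) (E.gain / E.cellVisc (m + 1) ^ 2) S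
        = E.toFractalCarrierData.kbar m • renormStep (Φ (E.toFractalCarrierData.cellVisc (m + 1)))
            (E.toFractalCarrierData.gain / E.toFractalCarrierData.cellVisc (m + 1) ^ 2) S from rfl,
      kbar_smul_renormStep_eq_cell E.toFractalCarrierData hL.permissible, smul_smul,
      show 1 / E.a (m + 1) * E.toFractalCarrierData.a (m + 1) = 1 by
        rw [show E.toFractalCarrierData.a (m + 1) = E.a (m + 1) from rfl]; field_simp, one_smul]
  rw [hcar, hten] at hv
  refine ⟨fun t' y => v₀ (1 / E.a (m + 1) * t') y, hv, ?_⟩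
  have r' := FluidPDE.Torus.ae_Ioo_comp_mul ha' r
  filter_upwards [r'] with t' ht'
  obtain ⟨hm, he⟩ := ht'
  rw [Lp.toLp_coeFn] at he
  exact ⟨hm, he⟩

/-- **(V) read on one grid window of the flat pair — modewise, cosine data, cell time, a.e.**  See the module docstring. -/
theorem ae_modeCoeff_window_sub_sq_le (E : LagrangianLatticeCarrier k) (hL : E.LPermissible) {W : LatticeWord k} {M : ℝ} {hM : 0 < M}
    (hdes : E.design = W.stretch M hM) {c : ℝ} (hgain : E.gain = c) (m : ℕ)
    {Φ : ℝ → FluidPDE.Torus.Visc4 (Fin 3) → FluidPDE.Torus.Visc4 (Fin 3)} {lo hi Λ β σ C ν₀ K : ℝ}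
    (hV : SlowVectorClauseF W M hM c Φ lo hi Λ β σ C ν₀ K) (hΛ : 1 ≤ Λ) (hlo : 0 < lo) (hν₀ : E.cellVisc (m + 1) < ν₀)
    {S : FluidPDE.Torus.Visc4 (Fin 3)} (hSo : FluidPDE.Torus.OddSmall S β) (hSn : FluidPDE.Torus.NearIso S lo hi)
    (hΦSn : FluidPDE.Torus.NearIso (Φ (E.cellVisc (m + 1)) S) lo hi)
    {Um Um1 : ℝ → ℝ → (V2 →L[ℝ] V2)}
    (hUm : FluidPDE.Torus.IsPropagator 1 (fun (_ : ℝ) (_ : UnitAddTorus (Fin 3)) => (0 : EuclideanSpace ℝ (Fin 3)))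
      (E.kbar m • renormStep (Φ (E.cellVisc (m + 1))) (E.gain / E.cellVisc (m + 1) ^ 2) S) Um)
    (hUm1 : FluidPDE.Torus.IsPropagator 1 (E.toFractalCarrierData.level (m + 1)) (E.kbar (m + 1) • S) Um1)
    (j : ℕ) {s : ℝ} (hsj : s = (j : ℝ) * E.refresh (m + 1)) (hs0 : 0 ≤ s) (hs1 : s < 1)
    {ℓ : Fin 3 → ℤ} (hℓ : ℓ ≠ 0) (hscale : ‖Torus.latticeVec ℓ‖ * (⌈K / E.cellVisc (m + 1)⌉₊ : ℝ) ≤ E.N (m + 1))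
    {p : EuclideanSpace ℝ (Fin 3)} (hp : ‖p‖ = 1) (hpℓ : ⟪p, Torus.latticeVec ℓ⟫_ℝ = 0) :
    ∀ᵐ t' ∂(volume.restrict (Ioo 0 ((1 - s) / (1 / E.a (m + 1))))),
      2 * ∑ i, ‖modeCoeff ℓ (⇑(Um1 s (s + 1 / E.a (m + 1) * t') ((memLp_singleMode ℓ p).toLp _)
            - Um s (s + 1 / E.a (m + 1) * t') ((memLp_singleMode ℓ p).toLp _))) i‖ ^ 2
        ≤ (C * (C * (E.cellVisc (m + 1) ^ σ + (‖Torus.latticeVec ℓ‖ * (⌈K / E.cellVisc (m + 1)⌉₊ : ℝ) / E.N (m + 1)) ^ σ)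
              * min 1 ((8 * Real.pi ^ 2 * ‖Torus.latticeVec ℓ‖ ^ 2 * (hi * Λ) * (E.cellVisc (m + 1) + c / E.cellVisc (m + 1)) / (E.N (m + 1) : ℝ) ^ 2) * t')
            + (8 * Real.pi ^ 2 * ‖Torus.latticeVec ℓ‖ ^ 2 * (hi * Λ) * (E.cellVisc (m + 1) + c / E.cellVisc (m + 1)) / (E.N (m + 1) : ℝ) ^ 2)
              * (M * W.period / E.cellVisc (m + 1)))) ^ 2
          * ∫ x, ‖(UnitAddTorus.mFourier ℓ x).re • p‖ ^ 2 := by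
  set ν := E.cellVisc (m + 1) with hν_def
  set a := E.a (m + 1) with ha_def
  set T := (1 - s) / (1 / a) with hT_def
  have hν : 0 < ν := cellVisc_pos' E.toFractalCarrierData (m + 1)
  have ha : 0 < a := E.a_pos (m + 1)
  have hT : 0 < T := by
    rw [hT_def]; have : 0 < 1 - s := by linarith
    positivity
  have h2T : 2 * (1 - s) / (1 / a) = 2 * T := by rw [hT_def]; ring
  -- the datum and its class
  set d : VF := fun x => (UnitAddTorus.mFourier ℓ x).re • p with hd_def
  have hd : MemLp d 2 volume := memLp_singleMode ℓ p
  have hddiv : FunctionSpaces.Torus.IsWeaklyDivFree d := isWeaklyDivFree_singleMode ℓ hpℓ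
  set xd : V2 := hd.toLp d with hxd_def
  have hxdiv : FunctionSpaces.Torus.IsWeaklyDivFree (xd : VF) := hddiv.congr_ae (MemLp.coeFn_toLp hd).symm
  -- the two orbits in cell time: `w` on `T`, `v` on `2T`
  obtain ⟨w, hw, hwU⟩ := exists_cellSol_of_window E hL hdes m hlo hSn hUm1 j hsj hs0 hs1 xd hxdiv
  obtain ⟨v, hv, hvU⟩ := exists_effSol_of_window₂ E hL m Φ hlo hSn hΦSn hUm hs0 hs1 xd hxdiv
  have hw' := hw.congr_datum (MemLp.coeFn_toLp hd).symm
  have hv' := hv.congr_datum (MemLp.coeFn_toLp hd).symm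
  rw [h2T, hgain] at hv'
  -- the clause
  have hodd : FluidPDE.Torus.OddSmall (ν • S) (ν * β) := hSo.smul ν
  have hwin : ∃ lam ∈ Set.Icc (1:ℝ) Λ, FluidPDE.Torus.NearIso (ν • S) (ν * (lo / lam)) (ν * (hi * lam)) :=
    ⟨1, ⟨le_rfl, hΛ⟩, by rw [div_one, mul_one]; exact hSn.smul hν.le⟩
  have key := (hV ν ⟨hν, hν₀⟩ (E.N (m + 1)) (ν • S) hodd hwin ℓ hℓ hscale p hp hpℓ T hT).2 w v hw' hv'
  filter_upwards [key, hwU, hvU] with t' hkey hwt hvt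
  obtain ⟨hmw, hew⟩ := hwt
  obtain ⟨hmv, hev⟩ := hvt
  -- `⇑(Um1 … xd − Um … xd) =ᵐ w t' − v t'`
  have hae : (⇑(Um1 s (s + 1 / a * t') xd - Um s (s + 1 / a * t') xd) : VF) =ᵐ[volume] fun x => w t' x - v t' x := by
    rw [← hew, ← hev]
    filter_upwards [Lp.coeFn_sub (hmw.toLp (w t')) (hmv.toLp (v t')), MemLp.coeFn_toLp hmw, MemLp.coeFn_toLp hmv] with x hx h1 h2
    rw [hx, Pi.sub_apply, h1, h2]
  have e : ∀ i, modeCoeff ℓ (⇑(Um1 s (s + 1 / a * t') xd - Um s (s + 1 / a * t') xd)) i = modeCoeff ℓ (fun x => w t' x - v t' x) i :=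
    fun i => modeCoeff_congr_ae hae ℓ i
  simp_rw [e]
  exact hkey

end Summit.AnomalousDissipation.AnomalousDissipation.Theorems.SolenoidalFractalHomogenisation.LagrangianStep.CellTime

end
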